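import Summits.ResolutionOfSingularities.ResolutionOfSingularities.Theorems.FrobeniusLadderFInjectiveMacaulayficationFiLocusOpenOfAffine
import Literature.AlgebraicGeometry.Morphisms.IsoOverOpen
import Mathlib.AlgebraicGeometry.Restrict
import HarnessLib

/-!
# Iso-locus transport of the stalk clauses (crux `FInjectiveMacaulayfication`, hole #3 plumbing H8)

[OURS · L1 W4.5a] Support file for crux stmt-ResolutionOfSingularities-15315
(`Summit.ResolutionOfSingularities.ResolutionOfSingularities.Theses.FrobeniusLadder.FInjectiveMacaulayfication`,
route `FrobeniusLadder`, registered skeleton v11 `86e9127b5c98b8e6`), helper **H8 `IsoLocusTransport`** of the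
crux planner's hole-#3 interfaces (CRUX-PLAN v3 §E / `HoleThreeInterfaces.lean`, item evidence
2026-08-26T22:59:30Z).  It is the CONFINEMENT PLUMBING every "ISO" line for the registered stub
`stub_genericFInjectivization` needs: a step `π : X₂ ⟶ X₁` of such a line is an isomorphism over some open
`U ⊆ X₁` (Mathlib: `IsIso (π ∣_ U)`), and over `U` nothing may change — at every point `x` of `X₂` with
`π x ∈ U` the stalk map `𝒪_{X₁, π x} ⟶ 𝒪_{X₂, x}` is a ring isomorphism (Mathlib `morphismRestrictStalkMap`:
the stalk maps of `π ∣_ U` and of `π` at `x` are isomorphic arrows), so each of the route's per-stalk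
clauses holds at `x` iff it holds at `π x`:

* §1 `isIso_stalkMap_of_isIso_morphismRestrict`, `nonempty_stalkRingEquiv_of_isIso_morphismRestrict` —
  the stalk map at a point over the iso-locus is an isomorphism / a ring isomorphism of stalks exists;
* §2 `fiClause_iff_of_isIso_morphismRestrict` (the FULL clause: domain ∧ every system of parameters weakly
  regular ∧ every parameter ideal Frobenius closed, the crux's inline form), `cmClause_iff_…` (the
  Cohen–Macaulay clause alone), `fClause_iff_…` (the Frobenius-closure clause alone), `isDomain_iff_…` —
  pointwise transport as `↔` (ring halves: `bundledClause_of_ringEquiv` below = the statement of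
  `Reductions.fiClause_of_ringEquiv` re-derived from the route-independent parts
  `FiLocusOpenOfAffine.cmClause_of_ringEquiv` / `fClause_of_ringEquiv` and Mathlib `MulEquiv.isDomain_iff`, so
  that this file does not import the route file);
* §3 `isoLocusTransport` — **H8 verbatim** (the planner's `IsoLocusTransport p` with its abbreviation
  `FiClause` unfolded; `HoleThree.IsoLocusTransport p` follows by `fun X₂ X₁ π U hU x hx => isoLocusTransport p
  X₂ X₁ π U hU x hx`), and the two set-level forms a line consumes: `fiClause_of_isIso_morphismRestrict`
  (if the full clause holds at every point of `U` then it holds at every point of `X₂` over `U`) and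
  `not_fiClause_base_of_isIso_morphismRestrict` (a bad point of `X₂` over `U` lies over a bad point of `X₁`);
* §4 `fiClause_comp_of_isIso_morphismRestrict` — towers: for `π₂ : X₃ ⟶ X₂`, `π₁ : X₂ ⟶ X₁` with `π₁` an
  isomorphism over `U` and `π₂` an isomorphism over `π₁ ⁻¹ᵁ U`, the composite is an isomorphism over `U`
  (`Literature.AlgebraicGeometry.Morphisms.isIso_morphismRestrict_comp`) and the clause transfers from the
  points of `U` to the points of `X₃` over `U`; `isIso_morphismRestrict_of_le` (loc. cit.) shrinks `U`.

Everything is folklore bookkeeping over Mathlib's `AlgebraicGeometry.morphismRestrict` /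
`morphismRestrictStalkMap` (Görtz–Wedhorn, *Algebraic Geometry I*, 2nd ed., Prop. 13.91 (3): local rings do
not change where a morphism restricts to an isomorphism); no definition is declared, the clauses are written
inline in the route file's vocabulary.  AI-written; weaker than expert review; no statement of
[claim: Hironaka2017] is used.
-/

-- single-problem summit: the doubled namespace component `ResolutionOfSingularities` is forced
set_option linter.dupNamespace false

noncomputable section

namespace Summit.ResolutionOfSingularities.ResolutionOfSingularities.Theorems.FInjectiveMacaulayfication.IsoLocusTransport

open CategoryTheory AlgebraicGeometry TopologicalSpace RingTheory.Sequence
open Summit.ResolutionOfSingularities.ResolutionOfSingularities.Theorems.FInjectiveMacaulayfication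

/-! ## §1 The stalk map over the iso-locus is an isomorphism -/

/-- If `π : X₂ ⟶ X₁` restricts to an isomorphism over the open `U ⊆ X₁` and `π x ∈ U`, then the stalk
map `𝒪_{X₁, π x} ⟶ 𝒪_{X₂, x}` is an isomorphism (the stalk maps of `π ∣_ U` and of `π` at `x` are
isomorphic arrows, Mathlib `morphismRestrictStalkMap`). [folklore] -/
-- adapted from `FRationalModification.CmCartierHull.isIso_stalkMap_of_isIso_morphismRestrict` (same three lines)
theorem isIso_stalkMap_of_isIso_morphismRestrict {X₂ X₁ : Scheme.{0}} (π : X₂ ⟶ X₁) (U : X₁.Opens)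
    [IsIso (π ∣_ U)] (x : X₂) (hx : π.base x ∈ U) : IsIso (π.stalkMap x) := by
  have hx' : x ∈ π ⁻¹ᵁ U := hx
  haveI : IsIso ((π ∣_ U).stalkMap ⟨x, hx'⟩) := inferInstance
  exact (Arrow.isIso_iff_isIso_of_isIso (morphismRestrictStalkMap π U ⟨x, hx'⟩).hom).mp this

/-- Over the iso-locus the stalks are ring-isomorphic: `𝒪_{X₁, π x} ≃+* 𝒪_{X₂, x}` for `π x ∈ U`,
`IsIso (π ∣_ U)`. [folklore] -/
theorem nonempty_stalkRingEquiv_of_isIso_morphismRestrict {X₂ X₁ : Scheme.{0}} (π : X₂ ⟶ X₁)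
    (U : X₁.Opens) [IsIso (π ∣_ U)] (x : X₂) (hx : π.base x ∈ U) :
    Nonempty (X₁.presheaf.stalk (π.base x) ≃+* X₂.presheaf.stalk x) :=
  haveI := isIso_stalkMap_of_isIso_morphismRestrict π U x hx
  ⟨(asIso (π.stalkMap x)).commRingCatIsoToRingEquiv⟩

/-- The full stalk clause of the crux at a ring — "domain, and for every system of parameters (`d = dim`
elements generating an ideal with maximal radical): weakly regular AND the ideal is Frobenius closed for the
exponent base `p`" (the route's bundled inline form) — transports along a ring isomorphism `e : A ≃+* B`.
Same statement as `Reductions.fiClause_of_ringEquiv`; assembled here from the route-independent transports of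
its three parts (`MulEquiv.isDomain_iff`, `FiLocusOpenOfAffine.cmClause_of_ringEquiv`,
`FiLocusOpenOfAffine.fClause_of_ringEquiv`). [folklore] -/
theorem bundledClause_of_ringEquiv (p : ℕ) {A B : Type} [CommRing A] [CommRing B] (e : A ≃+* B)
    (h : IsDomain A ∧ ∀ d : ℕ, ringKrullDim A = d → ∀ s : Fin d → A,
      (Ideal.span (Set.range s)).radical.IsMaximal →
        IsWeaklyRegular A (List.ofFn s) ∧
        ∀ y : A, (∃ n : ℕ, y ^ p ^ n ∈ Ideal.span ((fun z : A => z ^ p ^ n) ''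
          (Ideal.span (Set.range s) : Set A))) → y ∈ Ideal.span (Set.range s)) :
    IsDomain B ∧ ∀ d : ℕ, ringKrullDim B = d → ∀ s : Fin d → B,
      (Ideal.span (Set.range s)).radical.IsMaximal →
        IsWeaklyRegular B (List.ofFn s) ∧
        ∀ y : B, (∃ n : ℕ, y ^ p ^ n ∈ Ideal.span ((fun z : B => z ^ p ^ n) ''
          (Ideal.span (Set.range s) : Set B))) → y ∈ Ideal.span (Set.range s) := by
  obtain ⟨hdom, h⟩ := h
  have hcm := FiLocusOpenOfAffine.cmClause_of_ringEquiv e (fun d hd s hs => (h d hd s hs).1)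
  have hf := FiLocusOpenOfAffine.fClause_of_ringEquiv p e (fun d hd s hs => (h d hd s hs).2)
  exact ⟨(MulEquiv.isDomain_iff e.toMulEquiv).mp hdom, fun d hd s hs => ⟨hcm d hd s hs, hf d hd s hs⟩⟩

/-! ## §2 Pointwise transport of the clauses as equivalences -/

/-- **The full stalk clause over the iso-locus.** If `π : X₂ ⟶ X₁` is an isomorphism over the open
`U ⊆ X₁` and `π x ∈ U`, then "`𝒪` is a domain, every system of parameters (`d = dim` elements generating
an ideal with maximal radical) is weakly regular, and the ideal it generates is Frobenius closed for the
exponent base `p`" holds for `𝒪_{X₁, π x}` iff it holds for `𝒪_{X₂, x}` (transport along the stalk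
isomorphism, `bundledClause_of_ringEquiv`). [folklore] -/
theorem fiClause_iff_of_isIso_morphismRestrict (p : ℕ) {X₂ X₁ : Scheme.{0}} (π : X₂ ⟶ X₁)
    (U : X₁.Opens) [IsIso (π ∣_ U)] (x : X₂) (hx : π.base x ∈ U) :
    (IsDomain (X₁.presheaf.stalk (π.base x)) ∧
      ∀ d : ℕ, ringKrullDim (X₁.presheaf.stalk (π.base x)) = d →
        ∀ s : Fin d → X₁.presheaf.stalk (π.base x), (Ideal.span (Set.range s)).radical.IsMaximal →
          IsWeaklyRegular (X₁.presheaf.stalk (π.base x)) (List.ofFn s) ∧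
          ∀ y : X₁.presheaf.stalk (π.base x), (∃ e : ℕ, y ^ p ^ e ∈ Ideal.span
            ((fun z : X₁.presheaf.stalk (π.base x) => z ^ p ^ e) ''
              (Ideal.span (Set.range s) : Set (X₁.presheaf.stalk (π.base x))))) →
            y ∈ Ideal.span (Set.range s)) ↔
    (IsDomain (X₂.presheaf.stalk x) ∧
      ∀ d : ℕ, ringKrullDim (X₂.presheaf.stalk x) = d →
        ∀ s : Fin d → X₂.presheaf.stalk x, (Ideal.span (Set.range s)).radical.IsMaximal →
          IsWeaklyRegular (X₂.presheaf.stalk x) (List.ofFn s) ∧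
          ∀ y : X₂.presheaf.stalk x, (∃ e : ℕ, y ^ p ^ e ∈ Ideal.span
            ((fun z : X₂.presheaf.stalk x => z ^ p ^ e) ''
              (Ideal.span (Set.range s) : Set (X₂.presheaf.stalk x)))) →
            y ∈ Ideal.span (Set.range s)) := by
  haveI := isIso_stalkMap_of_isIso_morphismRestrict π U x hx
  let e : X₁.presheaf.stalk (π.base x) ≃+* X₂.presheaf.stalk x :=
    (asIso (π.stalkMap x)).commRingCatIsoToRingEquiv
  exact ⟨bundledClause_of_ringEquiv p e, bundledClause_of_ringEquiv p e.symm⟩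

/-- **The Cohen–Macaulay clause over the iso-locus** ("every system of parameters is a weakly regular
sequence"): it holds for `𝒪_{X₁, π x}` iff for `𝒪_{X₂, x}`, for `π` an isomorphism over `U ∋ π x`
(`FiLocusOpenOfAffine.cmClause_of_ringEquiv`). [folklore] -/
theorem cmClause_iff_of_isIso_morphismRestrict {X₂ X₁ : Scheme.{0}} (π : X₂ ⟶ X₁) (U : X₁.Opens)
    [IsIso (π ∣_ U)] (x : X₂) (hx : π.base x ∈ U) :
    (∀ d : ℕ, ringKrullDim (X₁.presheaf.stalk (π.base x)) = d →
        ∀ s : Fin d → X₁.presheaf.stalk (π.base x), (Ideal.span (Set.range s)).radical.IsMaximal →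
          IsWeaklyRegular (X₁.presheaf.stalk (π.base x)) (List.ofFn s)) ↔
    (∀ d : ℕ, ringKrullDim (X₂.presheaf.stalk x) = d →
        ∀ s : Fin d → X₂.presheaf.stalk x, (Ideal.span (Set.range s)).radical.IsMaximal →
          IsWeaklyRegular (X₂.presheaf.stalk x) (List.ofFn s)) := by
  haveI := isIso_stalkMap_of_isIso_morphismRestrict π U x hx
  let e : X₁.presheaf.stalk (π.base x) ≃+* X₂.presheaf.stalk x :=
    (asIso (π.stalkMap x)).commRingCatIsoToRingEquiv
  exact ⟨FiLocusOpenOfAffine.cmClause_of_ringEquiv e, FiLocusOpenOfAffine.cmClause_of_ringEquiv e.symm⟩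

/-- **The Frobenius-closure clause over the iso-locus** ("every parameter ideal is Frobenius closed for the
exponent base `p`", inline form): it holds for `𝒪_{X₁, π x}` iff for `𝒪_{X₂, x}`, for `π` an isomorphism over
`U ∋ π x` (`FiLocusOpenOfAffine.fClause_of_ringEquiv`). [folklore] -/
theorem fClause_iff_of_isIso_morphismRestrict (p : ℕ) {X₂ X₁ : Scheme.{0}} (π : X₂ ⟶ X₁)
    (U : X₁.Opens) [IsIso (π ∣_ U)] (x : X₂) (hx : π.base x ∈ U) :
    (∀ d : ℕ, ringKrullDim (X₁.presheaf.stalk (π.base x)) = d →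
        ∀ s : Fin d → X₁.presheaf.stalk (π.base x), (Ideal.span (Set.range s)).radical.IsMaximal →
          ∀ y : X₁.presheaf.stalk (π.base x), (∃ e : ℕ, y ^ p ^ e ∈ Ideal.span
            ((fun z : X₁.presheaf.stalk (π.base x) => z ^ p ^ e) ''
              (Ideal.span (Set.range s) : Set (X₁.presheaf.stalk (π.base x))))) →
            y ∈ Ideal.span (Set.range s)) ↔
    (∀ d : ℕ, ringKrullDim (X₂.presheaf.stalk x) = d →
        ∀ s : Fin d → X₂.presheaf.stalk x, (Ideal.span (Set.range s)).radical.IsMaximal →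
          ∀ y : X₂.presheaf.stalk x, (∃ e : ℕ, y ^ p ^ e ∈ Ideal.span
            ((fun z : X₂.presheaf.stalk x => z ^ p ^ e) ''
              (Ideal.span (Set.range s) : Set (X₂.presheaf.stalk x)))) →
            y ∈ Ideal.span (Set.range s)) := by
  haveI := isIso_stalkMap_of_isIso_morphismRestrict π U x hx
  let e : X₁.presheaf.stalk (π.base x) ≃+* X₂.presheaf.stalk x :=
    (asIso (π.stalkMap x)).commRingCatIsoToRingEquiv
  exact ⟨FiLocusOpenOfAffine.fClause_of_ringEquiv p e, FiLocusOpenOfAffine.fClause_of_ringEquiv p e.symm⟩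

/-- Over the iso-locus, `𝒪_{X₁, π x}` is a domain iff `𝒪_{X₂, x}` is. [folklore] -/
theorem isDomain_iff_of_isIso_morphismRestrict {X₂ X₁ : Scheme.{0}} (π : X₂ ⟶ X₁) (U : X₁.Opens)
    [IsIso (π ∣_ U)] (x : X₂) (hx : π.base x ∈ U) :
    IsDomain (X₁.presheaf.stalk (π.base x)) ↔ IsDomain (X₂.presheaf.stalk x) := by
  haveI := isIso_stalkMap_of_isIso_morphismRestrict π U x hx
  let e : X₁.presheaf.stalk (π.base x) ≃+* X₂.presheaf.stalk x :=
    (asIso (π.stalkMap x)).commRingCatIsoToRingEquiv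
  exact MulEquiv.isDomain_iff e.toMulEquiv

/-! ## §3 H8 verbatim and its set-level forms -/

/-- **H8 `IsoLocusTransport`** (CRUX-PLAN v3 §E, `HoleThreeInterfaces.IsoLocusTransport p` with the
abbreviation `FiClause` unfolded): for every `π : X₂ ⟶ X₁` which is an isomorphism over an open `U ⊆ X₁` and
every point `x` of `X₂` over `U`, the full stalk clause holds at `π x` iff it holds at `x`. [folklore] -/
theorem isoLocusTransport (p : ℕ) :
    ∀ (X₂ X₁ : Scheme.{0}) (π : X₂ ⟶ X₁) (U : X₁.Opens), IsIso (π ∣_ U) →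
      ∀ x : X₂, π.base x ∈ U →
        ((IsDomain (X₁.presheaf.stalk (π.base x)) ∧
          ∀ d : ℕ, ringKrullDim (X₁.presheaf.stalk (π.base x)) = d →
            ∀ s : Fin d → X₁.presheaf.stalk (π.base x), (Ideal.span (Set.range s)).radical.IsMaximal →
              IsWeaklyRegular (X₁.presheaf.stalk (π.base x)) (List.ofFn s) ∧
              ∀ y : X₁.presheaf.stalk (π.base x), (∃ e : ℕ, y ^ p ^ e ∈ Ideal.span
                ((fun z : X₁.presheaf.stalk (π.base x) => z ^ p ^ e) ''
                  (Ideal.span (Set.range s) : Set (X₁.presheaf.stalk (π.base x))))) →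
                y ∈ Ideal.span (Set.range s)) ↔
        (IsDomain (X₂.presheaf.stalk x) ∧
          ∀ d : ℕ, ringKrullDim (X₂.presheaf.stalk x) = d →
            ∀ s : Fin d → X₂.presheaf.stalk x, (Ideal.span (Set.range s)).radical.IsMaximal →
              IsWeaklyRegular (X₂.presheaf.stalk x) (List.ofFn s) ∧
              ∀ y : X₂.presheaf.stalk x, (∃ e : ℕ, y ^ p ^ e ∈ Ideal.span
                ((fun z : X₂.presheaf.stalk x => z ^ p ^ e) ''
                  (Ideal.span (Set.range s) : Set (X₂.presheaf.stalk x)))) →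
                y ∈ Ideal.span (Set.range s))) :=
  fun _ _ π U hU x hx => by
    haveI := hU
    exact fiClause_iff_of_isIso_morphismRestrict p π U x hx

/-- **Good over the iso-locus stays good.** If `π : X₂ ⟶ X₁` is an isomorphism over `U` and the full stalk
clause holds at every point of `U`, then it holds at every point of `X₂` over `U`. [folklore] -/
theorem fiClause_of_isIso_morphismRestrict (p : ℕ) {X₂ X₁ : Scheme.{0}} (π : X₂ ⟶ X₁)
    (U : X₁.Opens) [IsIso (π ∣_ U)]
    (hU : ∀ x₁ : X₁, x₁ ∈ U → IsDomain (X₁.presheaf.stalk x₁) ∧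
      ∀ d : ℕ, ringKrullDim (X₁.presheaf.stalk x₁) = d →
        ∀ s : Fin d → X₁.presheaf.stalk x₁, (Ideal.span (Set.range s)).radical.IsMaximal →
          IsWeaklyRegular (X₁.presheaf.stalk x₁) (List.ofFn s) ∧
          ∀ y : X₁.presheaf.stalk x₁, (∃ e : ℕ, y ^ p ^ e ∈ Ideal.span
            ((fun z : X₁.presheaf.stalk x₁ => z ^ p ^ e) ''
              (Ideal.span (Set.range s) : Set (X₁.presheaf.stalk x₁)))) →
            y ∈ Ideal.span (Set.range s))
    (x : X₂) (hx : π.base x ∈ U) :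
    IsDomain (X₂.presheaf.stalk x) ∧
      ∀ d : ℕ, ringKrullDim (X₂.presheaf.stalk x) = d →
        ∀ s : Fin d → X₂.presheaf.stalk x, (Ideal.span (Set.range s)).radical.IsMaximal →
          IsWeaklyRegular (X₂.presheaf.stalk x) (List.ofFn s) ∧
          ∀ y : X₂.presheaf.stalk x, (∃ e : ℕ, y ^ p ^ e ∈ Ideal.span
            ((fun z : X₂.presheaf.stalk x => z ^ p ^ e) ''
              (Ideal.span (Set.range s) : Set (X₂.presheaf.stalk x)))) →
            y ∈ Ideal.span (Set.range s) :=
  (fiClause_iff_of_isIso_morphismRestrict p π U x hx).mp (hU (π.base x) hx)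

/-- **Bad points over the iso-locus come from bad points.** If `π : X₂ ⟶ X₁` is an isomorphism over `U`,
`π x ∈ U`, and the full stalk clause FAILS at `x`, then it fails at `π x`: a confined step creates no new
bad point over its iso-locus. [folklore] -/
theorem not_fiClause_base_of_isIso_morphismRestrict (p : ℕ) {X₂ X₁ : Scheme.{0}} (π : X₂ ⟶ X₁)
    (U : X₁.Opens) [IsIso (π ∣_ U)] (x : X₂) (hx : π.base x ∈ U)
    (hbad : ¬ (IsDomain (X₂.presheaf.stalk x) ∧
      ∀ d : ℕ, ringKrullDim (X₂.presheaf.stalk x) = d →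
        ∀ s : Fin d → X₂.presheaf.stalk x, (Ideal.span (Set.range s)).radical.IsMaximal →
          IsWeaklyRegular (X₂.presheaf.stalk x) (List.ofFn s) ∧
          ∀ y : X₂.presheaf.stalk x, (∃ e : ℕ, y ^ p ^ e ∈ Ideal.span
            ((fun z : X₂.presheaf.stalk x => z ^ p ^ e) ''
              (Ideal.span (Set.range s) : Set (X₂.presheaf.stalk x)))) →
            y ∈ Ideal.span (Set.range s))) :
    ¬ (IsDomain (X₁.presheaf.stalk (π.base x)) ∧
      ∀ d : ℕ, ringKrullDim (X₁.presheaf.stalk (π.base x)) = d →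
        ∀ s : Fin d → X₁.presheaf.stalk (π.base x), (Ideal.span (Set.range s)).radical.IsMaximal →
          IsWeaklyRegular (X₁.presheaf.stalk (π.base x)) (List.ofFn s) ∧
          ∀ y : X₁.presheaf.stalk (π.base x), (∃ e : ℕ, y ^ p ^ e ∈ Ideal.span
            ((fun z : X₁.presheaf.stalk (π.base x) => z ^ p ^ e) ''
              (Ideal.span (Set.range s) : Set (X₁.presheaf.stalk (π.base x))))) →
            y ∈ Ideal.span (Set.range s)) :=
  fun h => hbad ((fiClause_iff_of_isIso_morphismRestrict p π U x hx).mp h)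

/-! ## §4 Towers of confined steps -/

/-- **Two confined steps.** For `π₂ : X₃ ⟶ X₂` and `π₁ : X₂ ⟶ X₁` with `π₁` an isomorphism over `U ⊆ X₁`
and `π₂` an isomorphism over `π₁ ⁻¹ᵁ U`, the composite `π₂ ≫ π₁` is an isomorphism over `U`
(`Literature.AlgebraicGeometry.Morphisms.isIso_morphismRestrict_comp`), and if the full stalk clause holds
at every point of `U` then it holds at every point of `X₃` over `U`. [folklore] -/
theorem fiClause_comp_of_isIso_morphismRestrict (p : ℕ) {X₃ X₂ X₁ : Scheme.{0}} (π₂ : X₃ ⟶ X₂)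
    (π₁ : X₂ ⟶ X₁) (U : X₁.Opens) [IsIso (π₁ ∣_ U)] [IsIso (π₂ ∣_ π₁ ⁻¹ᵁ U)]
    (hU : ∀ x₁ : X₁, x₁ ∈ U → IsDomain (X₁.presheaf.stalk x₁) ∧
      ∀ d : ℕ, ringKrullDim (X₁.presheaf.stalk x₁) = d →
        ∀ s : Fin d → X₁.presheaf.stalk x₁, (Ideal.span (Set.range s)).radical.IsMaximal →
          IsWeaklyRegular (X₁.presheaf.stalk x₁) (List.ofFn s) ∧
          ∀ y : X₁.presheaf.stalk x₁, (∃ e : ℕ, y ^ p ^ e ∈ Ideal.span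
            ((fun z : X₁.presheaf.stalk x₁ => z ^ p ^ e) ''
              (Ideal.span (Set.range s) : Set (X₁.presheaf.stalk x₁)))) →
            y ∈ Ideal.span (Set.range s)) :
    IsIso ((π₂ ≫ π₁) ∣_ U) ∧
    ∀ x : X₃, (π₂ ≫ π₁).base x ∈ U → IsDomain (X₃.presheaf.stalk x) ∧
      ∀ d : ℕ, ringKrullDim (X₃.presheaf.stalk x) = d →
        ∀ s : Fin d → X₃.presheaf.stalk x, (Ideal.span (Set.range s)).radical.IsMaximal →
          IsWeaklyRegular (X₃.presheaf.stalk x) (List.ofFn s) ∧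
          ∀ y : X₃.presheaf.stalk x, (∃ e : ℕ, y ^ p ^ e ∈ Ideal.span
            ((fun z : X₃.presheaf.stalk x => z ^ p ^ e) ''
              (Ideal.span (Set.range s) : Set (X₃.presheaf.stalk x)))) →
            y ∈ Ideal.span (Set.range s) := by
  haveI : IsIso ((π₂ ≫ π₁) ∣_ U) :=
    Literature.AlgebraicGeometry.Morphisms.isIso_morphismRestrict_comp π₂ π₁ U
  exact ⟨inferInstance, fun x hx => fiClause_of_isIso_morphismRestrict p (π₂ ≫ π₁) U hU x hx⟩

end Summit.ResolutionOfSingularities.ResolutionOfSingularities.Theorems.FInjectiveMacaulayfication.IsoLocusTransport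

end
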